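import Mathlib.Tactic
import HarnessLib

/-!
# Kozma–Nitzan's Question 8 — UNI-C(U;y): the cross-visibility kernels of LEMMA X (gen 40)

Support file (`--supports stmt-CriticalPhenomena-4575`, closed crux; independent mathematics on Kozma–Nitzan's Question 8,
arXiv:2401.12397 §5.5 p. 36), prover `prim-ineq-gen-6` (gen 40).  No definitions, no named facts, no sorries; standard axioms.
Memo `run/shared/lean/prim/prim-ineq-gen-6/PROOF-UNIC-LC-G40.md` §8 (LEMMA X).

LEMMA X keeps the term that the gen-37 kill budget dropped.  At a depth `l ≥ k₁` the U-identity reads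
`Ũ_l = u·L̃_l + v·(R̃_l − Γ_l u)` (`u, v ≥ 0` the A- and C-channel views beyond `l`), with `R̃_l − Γ_l u ≥ γ_l κ_l` and `Ũ_l ≥ 0`;
gen 37 used only `Ũ_l ≥ v γ_l κ_l⁺` (valid since `L̃_l ≥ 0`).  LEMMA X adds the CROSS term `u·L̃_l` with
`L̃_l ≥ a_l (1−γ_l)(Φπ − c − H_{l−1})` (C-death before `l` seen through the A-view beyond the dead edge `l+1`).  The kernels:
* `kX_utilde` — `Ũ ≥ max(v γ κ⁺, u L̃ + v γ κ)` from the identity, `R̃ − Γu ≥ γκ`, `L̃ ≥ 0`, `Ũ ≥ 0`, `u, v ≥ 0`;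
* `kX_corrL_step` — one step of `Σ_{k<l}(γ_k − γ_l)η_k ≤ (1 − γ_l)·H_{l−1}` (`γ_k ≤ 1`, `η_k ≤ η_k⁺`, `H` the cumulative positive emission);
* `kX_Ltilde` — `L̃ = a[(1−γ)P + M − corr]` with `M ≥ 0`, `corr ≤ (1−γ)H` gives `L̃ ≥ a(1−γ)(P − H)`;
* `kX_cross_sum_step` — one step of the aggregation `N ≥ Σ_l (1−s_{l+1})[u_l L̃_l + v_l γ_l κ_l − v_l γ_l κ_l⁺... ]/(γ_l p_l)`
  in the netted form used by the engines: `x ≥ max(B⁺, A + B)` implies `x ≥ B⁺ + (A − B⁻)` with `B = B⁺ − B⁻`.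
Exact link checks (X1)–(X4): lab-g40/g40/l13_cross.py (census n ≤ 7: 609 blocks, 1 473 nodes, 0 failures).
[cite: KozmaNitzan2024, Question 8 (§5.5 p. 36)]
-/

namespace Summit.CriticalPhenomena.PercolationContinuityZ3.Theorems

namespace PocketCert

/-- **Ũ lower bound with the cross term.**  From the U-identity `Ũ = u·L̃ + v·(R̃ − Γu)`, the kill-coefficient bound `R̃ − Γu ≥ γκ`,
`L̃ ≥ 0`, `Ũ ≥ 0` and `u, v ≥ 0`: both `Ũ ≥ v·γ·max(κ,0)` (gen 37) and `Ũ ≥ u·L̃ + v·γ·κ` (LEMMA X) hold.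
[cite: KozmaNitzan2024, Question 8 (§5.5 p. 36)] -/
theorem kX_utilde (Ut u v Lt Rt Γ γ κ : ℝ) (hid : Ut = u * Lt + v * (Rt - Γ * u)) (hR : γ * κ ≤ Rt - Γ * u)
    (hL : 0 ≤ Lt) (hU : 0 ≤ Ut) (hu : 0 ≤ u) (hv : 0 ≤ v) :
    v * γ * max κ 0 ≤ Ut ∧ u * Lt + v * γ * κ ≤ Ut := by
  have h2 : u * Lt + v * γ * κ ≤ Ut := by
    rw [hid]
    have : v * (γ * κ) ≤ v * (Rt - Γ * u) := mul_le_mul_of_nonneg_left hR hv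
    nlinarith [mul_nonneg hu hL]
  refine ⟨?_, h2⟩
  rcases le_or_gt κ 0 with hκ | hκ
  · rw [max_eq_right hκ]; simpa using hU
  · rw [max_eq_left hκ.le]
    nlinarith [mul_nonneg hu hL]

/-- **One step of the corrL bound.**  If the partial sum satisfies `acc ≤ (1 − γl)·H`, the next term has `γk ≤ 1`, `γl ≤ γk`,
`η ≤ ηp` with `0 ≤ ηp`, then `acc + (γk − γl)·η ≤ (1 − γl)·(H + ηp)`.  Iterating: `Σ_{k<l}(γ_k − γ_l)η_k ≤ (1 − γ_l)·H_{l−1}`.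
[cite: KozmaNitzan2024, Question 8 (§5.5 p. 36)] -/
theorem kX_corrL_step (acc H γk γl η ηp : ℝ) (hacc : acc ≤ (1 - γl) * H) (hk : γk ≤ 1) (hkl : γl ≤ γk)
    (hη : η ≤ ηp) (hp : 0 ≤ ηp) :
    acc + (γk - γl) * η ≤ (1 - γl) * (H + ηp) := by
  have h1 : (γk - γl) * η ≤ (γk - γl) * ηp := mul_le_mul_of_nonneg_left hη (by linarith)
  have h2 : (γk - γl) * ηp ≤ (1 - γl) * ηp := mul_le_mul_of_nonneg_right (by linarith) hp
  nlinarith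

/-- **The cross coefficient.**  `L̃ = a·[(1−γ)·P + M − corr]` with `a ≥ 0`, `M ≥ 0` (the `Φ(M_l − γ_l E_l)` term) and
`corr ≤ (1−γ)·H` gives `L̃ ≥ a·(1−γ)·(P − H)`: C-death before depth `l` is visible through the A-view beyond a dead edge at
strength `Φπ − c − H_{l−1}`.
[cite: KozmaNitzan2024, Question 8 (§5.5 p. 36)] -/
theorem kX_Ltilde (Lt a γ P M corr H : ℝ) (hdef : Lt = a * ((1 - γ) * P + M - corr)) (ha : 0 ≤ a) (hM : 0 ≤ M)
    (hcorr : corr ≤ (1 - γ) * H) :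
    a * (1 - γ) * (P - H) ≤ Lt := by
  rw [hdef]
  have : (1 - γ) * P + M - corr ≥ (1 - γ) * (P - H) := by nlinarith
  nlinarith [mul_le_mul_of_nonneg_left this ha]

/-- **Netted aggregation step.**  If `x ≥ (A + B)·w` — the second lower bound of `kX_utilde` scaled by the weight
`w = (1−s_{l+1})/(γ_l p_l)` — then `x ≥ (max(B,0) + (A − max(−B,0)))·w`: the kill part `B⁺` (what the per-defect kill weights
`KW_w` collect) and the cross part net of the negative kill coefficient, `A − B⁻`, add up inside `N` (form (X1) of LEMMA X).
[cite: KozmaNitzan2024, Question 8 (§5.5 p. 36)] -/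
theorem kX_cross_sum_step (x A B w : ℝ) (h2 : (A + B) * w ≤ x) :
    (max B 0 + (A - max (-B) 0)) * w ≤ x := by
  rcases le_or_gt B 0 with hB | hB
  · rw [max_eq_right hB, max_eq_left (by linarith : (0:ℝ) ≤ -B)]
    have : (0 + (A - -B)) * w = (A + B) * w := by ring
    linarith [this]
  · rw [max_eq_left hB.le, max_eq_right (by linarith : -B ≤ (0:ℝ))]
    have : (B + (A - 0)) * w = (A + B) * w := by ring
    linarith [this]

end PocketCert

end Summit.CriticalPhenomena.PercolationContinuityZ3.Theorems
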